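import Mathlib
import Summits.Ventures.HodgeRepro2.HeckeSlashDoubleCoset

/-!
# HeckeRepIndependence — `T_δ f` is the same sum for ANY system of right-coset representatives

Blind cell `pub-hodge-repro2`, seat p2 (Tier 5 kernel support, Hecke side).

`HeckeSlashOperator.lean` defines `T_δ f = Σ_{q ∈ S/S_δ} f ∥_k (δ r_q)` with the specific
representatives `r_q = (out q)⁻¹`. This file records that any other choice `α_q ∈ S δ r_q` of
representatives of the right cosets `S α ⊆ S δ S` gives the same function on the ball:

* `hecke_eq_sum_rep`: `T_δ f z = Σ_q f ∥_k α_q (z)` whenever `α_q (δ r_q)⁻¹ ∈ S` for all `q`;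
* `hecke_eq_sum_rep'`: the same with the hypothesis in the form `α_q = s_q δ r_q`, `s_q ∈ S`.

Both are immediate from `slash_realEmbedding_mul_left` (row 137): `f ∥ (γα) = f ∥ α` for `γ ∈ S`.
-/

namespace Summit.Ventures.HodgeRepro2.ShimuraData

open Finset

variable {K : Type*} [Field K] [NumberField K] [NumberField.IsCMField K] {τ₁ : K →+* ℂ}
  {H : Matrix (Fin 3) (Fin 3) K} {Q : Matrix (Fin 3) (Fin 3) ℂ}

/-- **Representative independence of `T_δ`.** For any choice `rep q` of representatives with
`rep q ∈ S δ r_q` (i.e. `rep q (δ r_q)⁻¹ ∈ S`), `T_δ f z = Σ_q f ∥_k (rep q) (z)` on the ball. -/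
theorem hecke_eq_sum_rep (hQ : IsFrame K τ₁ H Q) {S : Subgroup (GL (Fin 3) K)}
    (hS : (S : Set (GL (Fin 3) K)) ⊆ unitaryGroup K H) {δ : GL (Fin 3) K}
    (hδ : δ ∈ unitaryGroup K H) [Fintype (S ⧸ (heckeSubgroup S δ).subgroupOf S)]
    {k : ℕ} {f : (Fin 2 → ℂ) → ℂ} (hf : IsWeightFor τ₁ Q S k f) {z : Fin 2 → ℂ} (hz : z ∈ ball₂)
    (rep : S ⧸ (heckeSubgroup S δ).subgroupOf S → GL (Fin 3) K)
    (hrep : ∀ q, rep q * (δ * (heckeRep S δ q : GL (Fin 3) K))⁻¹ ∈ S) :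
    hecke S δ τ₁ Q k f z = ∑ q, slash k (realEmbedding K τ₁ Q (rep q)) f z := by
  simp only [hecke]
  refine Finset.sum_congr rfl fun q _ => ?_
  have hα : δ * (heckeRep S δ q : GL (Fin 3) K) ∈ unitaryGroup K H :=
    mul_mem hδ (hS (heckeRep S δ q).2)
  have hrepq : rep q = rep q * (δ * (heckeRep S δ q : GL (Fin 3) K))⁻¹
      * (δ * (heckeRep S δ q : GL (Fin 3) K)) := by group
  rw [hrepq, slash_realEmbedding_mul_left hQ hS hf (hrep q) hα hz]

/-- **Representative independence of `T_δ`**, with the representatives given as `rep q = s_q δ r_q`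
for some `s_q ∈ S`. -/
theorem hecke_eq_sum_rep' (hQ : IsFrame K τ₁ H Q) {S : Subgroup (GL (Fin 3) K)}
    (hS : (S : Set (GL (Fin 3) K)) ⊆ unitaryGroup K H) {δ : GL (Fin 3) K}
    (hδ : δ ∈ unitaryGroup K H) [Fintype (S ⧸ (heckeSubgroup S δ).subgroupOf S)]
    {k : ℕ} {f : (Fin 2 → ℂ) → ℂ} (hf : IsWeightFor τ₁ Q S k f) {z : Fin 2 → ℂ} (hz : z ∈ ball₂)
    (rep : S ⧸ (heckeSubgroup S δ).subgroupOf S → GL (Fin 3) K)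
    (hrep : ∀ q, ∃ s ∈ S, rep q = s * (δ * (heckeRep S δ q : GL (Fin 3) K))) :
    hecke S δ τ₁ Q k f z = ∑ q, slash k (realEmbedding K τ₁ Q (rep q)) f z := by
  refine hecke_eq_sum_rep hQ hS hδ hf hz rep fun q => ?_
  obtain ⟨s, hs, hsq⟩ := hrep q
  rw [hsq, mul_inv_cancel_right]
  exact hs

end Summit.Ventures.HodgeRepro2.ShimuraData
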